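import Literature.NumberTheory.LFunctions.Zhang2022.KnifeEdgeEStarLen
import Literature.Barriers.Parity.SiegelZeroDichotomyPairHLSiegelModel
import Literature.Barriers.Parity.SiegelZeroPrimePairsInitialSteps
import Literature.NumberTheory.LFunctions.ExceptionalZeroFromSmallLOne
import Literature.NumberTheory.LFunctions.SiegelZeroQualityBound

/-!
# Zhang (2022), rung F-S3 (Landau–Siegel programme, §D edge len = E*-len⁺): crux idea card
# `siegel-model-moduli` (ls-knife-len-idea-2, filed `Parity/GeneralizedHardyLittlewood/siegel-model-moduli`,
# commit f3fd35ca5c6c) — its FIRST LEMMA «Siegel model of the FAMILY INDEX» and companions, TYPED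

Y. Zhang, *Discrete mean estimates and the Landau–Siegel zero*, arXiv:2211.02515v1 [Zhang2022LandauSiegel] — an
unrefereed manuscript under adjudication; T. Tao, J. Teräväinen, *The Hardy–Littlewood–Chowla conjecture in the
presence of a Siegel zero* [TaoTeravainen2021] (the Siegel model `Λ_Siegel = (χ ∗ log)·ν`). **WHAT THIS IS NOT: not a
claim about Theorems 1–2 of arXiv:2211.02515, about Landau–Siegel zeros, or about Parity. The programme SEARCHES and
TYPES; no claim about Landau–Siegel zeros, Theorems 1–2 of arXiv:2211.02515 or a repaired Margin232 until a kernel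
theorem says so. `SiegelModuliTransfer`, `SiegelFractionTransfer`, `SiegelFractionCompletes` are the CARD'S CLAIMS typed
as bare `Prop`s (OPEN — asserted by no one); the only theorems here are the sign of the Siegel weight
(`siegelModulusWeight_nonneg`, the card's support item P1, from `MatomakiMerikoski.oneConvChi_nonneg`) and bookkeeping.**

THE LEVER (card §Lever, verbatim in substance). Under (A) the MODULUS variable of Zhang's family `Ψ = {ψ mod p : p ∼ P}`
is linearised: `Λ(m) ↦ Λ_Siegel(m) = (χ ∗ log)(m)·ν_R(m)` (`TaoTeravainen.vonMangoldtSiegel`, `R = exp 𝓛⁸`) with `ℓ¹`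
error `≤ |W|·𝓛^{−c}`; every modulus-side sum `Σ_p log p·G(p)` (the `𝔒_δ` of E-001/E-002, the `p`-sum of (14.8) in
E-016, E-006's outer sum) becomes `Σ_m Λ_Siegel(m)·G(m)`, a positive Eisenstein divisor-class family of level
`P^{2/𝓛}` — factorable / densely divisible.  The lever acts on the MODULUS-side calculus (the off-diagonal `X`), not on
the coefficient profile: it does not touch the hypotheses of `KnifeEdgeInvisibleTail.tailInvisible` (F-len-1 honoured,
not evaded); the class question (FORM A: `EStarLenPlusShape c' θ X 𝒱` with `X :=` the K1–K2 formula) is the card's K3,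
OPEN.  Typed here: K1 `SiegelModuliTransfer c` (the transfer identity), its first instance `SiegelFractionTransfer c`
(Kloosterman fractions), the K2 shape `SiegelFractionCompletes ϑ η` (Ramanujan completion — STRUCK 2026-08-27: misstated
as typed, ⟺ `¬(A)` eventually for `0 < ϑ, η`, see its docstring; documentation only), over the tree's
`Skeleton.primeWindow/bigP/ell/ForAllLarge/AssumptionA` (pinned scales, `P = exp 𝓛⁹`) and the tree's Tao–Teräväinen
vocabulary.  Statements verbatim from the ideator's `Sketch-siegel-model-moduli.lean` (HOME/knife/len/idea-2/, farm rc 0);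
typer: ls-knife-typer-1 (cell landau-siegel §D).

## References
* Y. Zhang, arXiv:2211.02515v1 (2022), §2 p.4 (the family `Ψ`, `p ∼ P`), (2.9), §14 (14.8). [cite: Zhang2022LandauSiegel, §2, §14]
* T. Tao, J. Teräväinen, arXiv:2109.06291, §5 (the Siegel model), (3.13). [cite: TaoTeravainen2021, §5]
-/

noncomputable section

open Finset Real Complex ComplexConjugate
open scoped ArithmeticFunction.vonMangoldt

namespace Literature.NumberTheory.LFunctions.Zhang2022.KnifeEdge

open Skeleton
open Literature.Barriers.Parity.TaoTeravainen (IsSmoothCutoff vonMangoldtSiegel charLog selbergSieve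
  charLog_eq_sum selbergSieve_nonneg)
open Literature.Barriers.Parity.MatomakiMerikoski (oneConvChi_nonneg)

/-! ### Part 1 — the window of moduli and the Siegel weight on the family index -/

/-- The INTEGER window `(P, P(1 + 𝓛⁻⁶⁸))`: Zhang's `Skeleton.primeWindow D` without the primality filter
(`primeWindow_eq_filter`). [cite: Zhang2022LandauSiegel, §2 p.4] -/
def moduliWindow (D : ℕ) : Finset ℕ :=
  Finset.Ioo ⌊bigP D⌋₊ ⌈bigP D * (1 + (ell D ^ 68)⁻¹)⌉₊

/-- `primeWindow D = (moduliWindow D).filter Nat.Prime`. [cite: Zhang2022LandauSiegel, §2 p.4] -/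
theorem primeWindow_eq_filter (D : ℕ) : primeWindow D = (moduliWindow D).filter Nat.Prime := rfl

/-- The Selberg-sieve level of the Siegel model on the modulus variable: `R = exp(𝓛⁸) = P^{1/𝓛}` (any `P^{o(1)}`
beyond `exp(𝓛^{1+ε})` would do; the sieve part of `Λ_Siegel` then has level `R² = P^{2/𝓛}`).
[cite: TaoTeravainen2021, §2.4 (2.3), §5] -/
def siegelLevel (D : ℕ) : ℝ := Real.exp (ell D ^ 8)

/-- **The Siegel weight on the MODULUS**: `Λ_Siegel(m) = (χ ∗ log)(m)·ν_R(m)` with `R = siegelLevel D` and smooth cutoff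
`ψc` — Tao–Teräväinen's model of `Λ` (`TaoTeravainen.vonMangoldtSiegel`), evaluated on the family index `m ∼ P`.
[cite: TaoTeravainen2021, §5 (display before (5.2))] -/
def siegelModulusWeight {D : ℕ} (χ : DirichletCharacter ℂ D) (ψc : ℝ → ℝ) (m : ℕ) : ℝ :=
  vonMangoldtSiegel χ ψc (siegelLevel D) m

/-- The card's support item P1 as a `Prop`: the Siegel weight is `≥ 0` for quadratic `χ` (PROVED below,
`siegelModulusWeightNonneg_holds`). [cite: TaoTeravainen2021, §5; MatomakiMerikoski2023, §2 (after (2.1))] -/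
def SiegelModulusWeightNonneg : Prop :=
  ∀ (D : ℕ) (χ : DirichletCharacter ℂ D), χ.IsQuadratic → ∀ (ψc : ℝ → ℝ) (m : ℕ),
    0 ≤ siegelModulusWeight χ ψc m


/-- **P1 PROVED:** `Λ_Siegel(m) = (Σ_{d∣m} (1∗χ)(d)·Λ(m/d))·ν_R(m) ≥ 0` for quadratic `χ`
(`MatomakiMerikoski.oneConvChi_nonneg`, `TaoTeravainen.charLog_eq_sum`, `selbergSieve_nonneg`).
[cite: TaoTeravainen2021, §5 (proof of Lemma 5.1)] -/
theorem siegelModulusWeight_nonneg {D : ℕ} {χ : DirichletCharacter ℂ D} (hχ : χ.IsQuadratic) (ψc : ℝ → ℝ)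
    (m : ℕ) : 0 ≤ siegelModulusWeight χ ψc m := by
  unfold siegelModulusWeight vonMangoldtSiegel
  refine mul_nonneg ?_ (selbergSieve_nonneg _ _ _)
  rw [charLog_eq_sum]
  exact Finset.sum_nonneg fun d _ => mul_nonneg (oneConvChi_nonneg χ hχ d) ArithmeticFunction.vonMangoldt_nonneg

/-- P1 in the card's `Prop` form. [cite: TaoTeravainen2021, §5] -/
theorem siegelModulusWeightNonneg_holds : SiegelModulusWeightNonneg :=
  fun _ _ hχ ψc m => siegelModulusWeight_nonneg hχ ψc m

/-! ### Part 2 — K1, the FIRST LEMMA: the transfer identity for the family index (OPEN, typed) -/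

/-- **FIRST LEMMA of card `siegel-model-moduli` — the transfer identity for the family index (OPEN; asserted by no
one).** Under (A), eventually in `D`, for every nonnegative `G` bounded by `B`,
`|Σ_{p ∈ primeWindow} (log p)·G(p) − Σ_{m ∈ moduliWindow} Λ_Siegel(m)·G(m)| ≤ B·|window|·𝓛^{−c}`, `|window| = P·𝓛⁻⁶⁸`.
The exponent `c` is what (A)'s exponent `2022` buys (Heath-Brown 1983 / Tao–Teräväinen Prop. 5.2 genre: the `ℓ¹`
distance of `Λ` and `Λ_Siegel` on `[x, x + x𝓛⁻⁶⁸]` is `≪ ((1−β)·log x)^{c₀}·x𝓛⁻⁶⁸`, and (A) forces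
`(1−β)·log P ≤ 𝓛^{9−2022+O(1)}`; tree: `SiegelZero.TaoTeravainen2021_eq313`).  The card claims it with `c ≈ 1990`.
NB the threshold `D₀` of `ForAllLarge` depends on `ψc` only — the bound is uniform in `(G, B)`.
[cite: Zhang2022LandauSiegel, §2 p.4, (2.9); TaoTeravainen2021, §5 Prop. 5.2, (3.13)] -/
def SiegelModuliTransfer (c : ℝ) : Prop :=
  ∀ ψc : ℝ → ℝ, IsSmoothCutoff ψc →
    ForAllLarge fun D _ χ => AssumptionA D χ →
      ∀ (G : ℕ → ℝ) (B : ℝ), (∀ m, 0 ≤ G m) → (∀ m, G m ≤ B) →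
        |∑ p ∈ primeWindow D, Real.log p * G p
            - ∑ m ∈ moduliWindow D, siegelModulusWeight χ ψc m * G m|
          ≤ B * (bigP D * (ell D ^ 68)⁻¹) * (ell D ^ c)⁻¹

/-! ### Part 3 — K1 on Kloosterman fractions and the K2 completion shape (OPEN, typed) -/

/-- The modulus-side Kloosterman-fraction sum of the architecture (shape of (14.8) / E-016 and of the off-diagonal
`𝔒_δ` of E-001/E-002 after Poisson in `n (mod p)`): `Σ_{p ∼ P} (log p)·β(p)·e(−l·p̄/q)`, `p̄` the inverse of `p`
modulo `q` (junk `0` when not invertible). [cite: Zhang2022LandauSiegel, §14 (14.8)] -/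
def primeKloostermanFraction (D : ℕ) (β : ℕ → ℂ) (q l : ℕ) : ℂ :=
  ∑ p ∈ primeWindow D, (Real.log p : ℂ) * β p *
    Complex.exp (-(2 * Real.pi * Complex.I * l * (((p : ZMod q)⁻¹).val : ℂ) / q))

/-- The same sum with the prime support replaced by the Siegel weight on ALL moduli of the window:
`Σ_{m ∈ window} Λ_Siegel(m)·β(m)·e(−l·m̄/q)` — a divisor-class (Eisenstein, conductor `D`, sieve level `P^{2/𝓛}`) weight
against a Kloosterman fraction, to which completion modulo `q` (Ramanujan sums) and divisor switching apply.
[cite: Zhang2022LandauSiegel, §14 (14.8); TaoTeravainen2021, §5] -/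
def siegelKloostermanFraction {D : ℕ} (χ : DirichletCharacter ℂ D) (ψc : ℝ → ℝ)
    (β : ℕ → ℂ) (q l : ℕ) : ℂ :=
  ∑ m ∈ moduliWindow D, (siegelModulusWeight χ ψc m : ℂ) * β m *
    Complex.exp (-(2 * Real.pi * Complex.I * l * (((m : ZMod q)⁻¹).val : ℂ) / q))

/-- **K1 in its first concrete instance (OPEN; the card states it as a direct corollary of `SiegelModuliTransfer` applied
to the four sign parts of the summand):** for bounded `β` the prime Kloosterman-fraction sum equals the Siegel-weighted
one up to `4B·|window|·𝓛^{−c}`, uniformly in the modulus `q ≤ P` and the frequency `l`.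
[cite: Zhang2022LandauSiegel, §14 (14.8); TaoTeravainen2021, §5] -/
def SiegelFractionTransfer (c : ℝ) : Prop :=
  ∀ ψc : ℝ → ℝ, IsSmoothCutoff ψc →
    ForAllLarge fun D _ χ => AssumptionA D χ →
      ∀ (β : ℕ → ℂ) (B : ℝ), (∀ m, ‖β m‖ ≤ B) → ∀ q l : ℕ, (q : ℝ) ≤ bigP D →
        ‖primeKloostermanFraction D β q l - siegelKloostermanFraction χ ψc β q l‖
          ≤ 4 * B * (bigP D * (ell D ^ 68)⁻¹) * (ell D ^ c)⁻¹

/-- **K2 shape — the payoff's first rung (OPEN): COMPLETION of the Siegel-weighted Kloosterman fraction.** For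
moduli `q ≤ P^ϑ` (inside the range `Dk ≤ 2DPT⁻²t₀` of (14.8)) the `m`-sum covers `≥ exp(𝓛^{1.1})` full periods; for
SMOOTH `β` (sup `≤ 1`, Lipschitz constant `≤ 1/P`) the sum is its Ramanujan-sum main term (`c_q(l) = μ(q)` for
`(l,q) = 1`) plus a power saving `P^{−η}` in the number of periods.  (The card's own caveat: the sieve factor `ν_R` and
the `χ ∗ log` structure make the weight equidistributed in classes mod `q` only on average over classes — a level of
distribution of a divisor-class function; the statement asks it against the test function `x ↦ e(−l x̄/q)`.)

**STRUCK 2026-08-27 (ls-knife-typer-1 g3) — DOCUMENTATION ONLY, MISSTATED AS TYPED; bytes kept.** Desk probe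
`T1ProbeLS.LenK2.siegelFractionCompletes_iff_evNotA` (frontier-trib-ls-1 g5, SiegelFractionJunk.lean v2 221c96ec4e066765,
rc 0): TRUE for `ϑ ≤ 0`; for `0 < ϑ, η` EQUIVALENT to `ForAllLarge (¬ AssumptionA)` (all-`m` sum with Mathlib's junk
inverse `(m : ZMod q)⁻¹ = 0` at `q ∣ m` vs the untwisted main term `μ(q)/φ(q)·Σ_m`, against `Σ_{q₀∣m∈W} Λ_Siegel(m) ≥ log p`
at `m = q₀²p`). Honest repair = `(m,q) = 1` on both sums and `(q,D) = 1` or the `χ·τ(χ)` main term at `q = D·k` (desk memo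
§3); not re-typed — card conceded by its author 2026-08-27T00:52:37Z, no line routes through it. DO NOT cite as a rung.
[cite: Zhang2022LandauSiegel, §14 (14.8); TaoTeravainen2021, §5] -/
def SiegelFractionCompletes (ϑ η : ℝ) : Prop :=
  ∀ ψc : ℝ → ℝ, IsSmoothCutoff ψc →
    ForAllLarge fun D _ χ => AssumptionA D χ →
      ∀ (β : ℕ → ℂ), (∀ m, ‖β m‖ ≤ 1) →
        (∀ m m' : ℕ, ‖β m - β m'‖ ≤ |(m : ℝ) - m'| / bigP D) →
        ∀ q l : ℕ, 0 < q → (q : ℝ) ≤ bigP D ^ ϑ → Nat.Coprime l q →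
          ‖siegelKloostermanFraction χ ψc β q l
              - ((∑ m ∈ moduliWindow D, (siegelModulusWeight χ ψc m : ℂ) * β m) / (q.totient : ℂ))
                * (ArithmeticFunction.moebius q : ℂ)‖
            ≤ bigP D * (ell D ^ 68)⁻¹ * (bigP D) ^ (-η)


/-! ### Part 4 — bookkeeping (proved) -/

/-- The Siegel-weighted side of K1 is a sum of NONNEGATIVE terms for `G ≥ 0` and quadratic `χ` (so the transferred
family is a positive family — the «divisor-class family» of the lever). [cite: TaoTeravainen2021, §5] -/
theorem siegel_side_nonneg {D : ℕ} {χ : DirichletCharacter ℂ D} (hχ : χ.IsQuadratic) (ψc : ℝ → ℝ)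
    {G : ℕ → ℝ} (hG : ∀ m, 0 ≤ G m) :
    0 ≤ ∑ m ∈ moduliWindow D, siegelModulusWeight χ ψc m * G m :=
  Finset.sum_nonneg fun m _ => mul_nonneg (siegelModulusWeight_nonneg hχ ψc m) (hG m)

/-- `SiegelModuliTransfer` is monotone in the exponent: a transfer with saving `𝓛^{−c}` gives every weaker saving
`𝓛^{−c'}`, `c' ≤ c` (for `𝓛 ≥ 1`, i.e. eventually). [cite: Zhang2022LandauSiegel, §2 p.4] -/
theorem SiegelModuliTransfer.mono {c c' : ℝ} (hcc : c' ≤ c) (h : SiegelModuliTransfer c) : SiegelModuliTransfer c' := by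
  intro ψc hψ
  have hev := (h ψc hψ).and (ForAllLarge.of_le (S := fun D _ _ => 1 ≤ ell D) 3 fun D _ χ hD _ _ => by
    have h3 : (3 : ℝ) ≤ D := by exact_mod_cast hD
    have : Real.exp 1 < 3 := lt_trans Real.exp_one_lt_d9 (by norm_num)
    have h1 : (1 : ℝ) = Real.log (Real.exp 1) := (Real.log_exp 1).symm
    rw [h1]
    exact Real.log_le_log (Real.exp_pos 1) (by linarith))
  refine hev.mono fun D _ χ _ _ hh hA G B hG hB => ?_
  obtain ⟨h1, hℓ⟩ := hh
  refine (h1 hA G B hG hB).trans ?_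
  have hB0 : 0 ≤ B := (hG 0).trans (hB 0)
  have hW : 0 ≤ bigP D * (ell D ^ 68)⁻¹ := mul_nonneg (Real.exp_pos _).le (inv_nonneg.mpr (by positivity))
  refine mul_le_mul_of_nonneg_left ?_ (mul_nonneg hB0 hW)
  exact inv_anti₀ (Real.rpow_pos_of_pos (by linarith) _) (Real.rpow_le_rpow_of_exponent_le hℓ hcc)

/-! ### Part 5 — P2 PROVED from K1 (appended 2026-08-26): `SiegelModuliTransfer c → SiegelFractionTransfer c` -/

section FractionTransfer

variable {D : ℕ} (χ : DirichletCharacter ℂ D) (ψc : ℝ → ℝ)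

/-- The transfer defect of a complex test function `H` on the window:
`Σ_{p ∈ primeWindow} (log p)·H(p) − Σ_{m ∈ moduliWindow} Λ_Siegel(m)·H(m)`. [cite: Zhang2022LandauSiegel, §2 p.4] -/
def transferDefect (H : ℕ → ℂ) : ℂ :=
  ∑ p ∈ primeWindow D, (Real.log p : ℂ) * H p - ∑ m ∈ moduliWindow D, (siegelModulusWeight χ ψc m : ℂ) * H m

/-- The defect is additive in the test function. [cite: Zhang2022LandauSiegel, §2 p.4] -/
theorem transferDefect_add (H₁ H₂ : ℕ → ℂ) :
    transferDefect χ ψc (fun m => H₁ m + H₂ m) = transferDefect χ ψc H₁ + transferDefect χ ψc H₂ := by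
  simp only [transferDefect, mul_add, Finset.sum_add_distrib]
  ring

/-- The defect is homogeneous in the test function. [cite: Zhang2022LandauSiegel, §2 p.4] -/
theorem transferDefect_smul (a : ℂ) (H : ℕ → ℂ) :
    transferDefect χ ψc (fun m => a * H m) = a * transferDefect χ ψc H := by
  simp only [transferDefect, mul_sub, Finset.mul_sum]
  congr 1 <;> exact Finset.sum_congr rfl fun m _ => by ring

/-- On a real test function the defect is the real transfer difference of K1. [cite: Zhang2022LandauSiegel, §2 p.4] -/
theorem transferDefect_ofReal (G : ℕ → ℝ) :
    transferDefect χ ψc (fun m => (G m : ℂ))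
      = ((∑ p ∈ primeWindow D, Real.log p * G p - ∑ m ∈ moduliWindow D, siegelModulusWeight χ ψc m * G m : ℝ) : ℂ) := by
  simp only [transferDefect]
  push_cast
  rfl

/-- Decomposition of a complex test function into four nonnegative real parts. [cite: Zhang2022LandauSiegel, §2 p.4] -/
private theorem decomp_four (z : ℂ) :
    z = (((max z.re 0 : ℝ) : ℂ) - ((max (-z.re) 0 : ℝ) : ℂ))
        + (((max z.im 0 : ℝ) : ℂ) - ((max (-z.im) 0 : ℝ) : ℂ)) * I := by
  have hre : ((max z.re 0 : ℝ) : ℂ) - ((max (-z.re) 0 : ℝ) : ℂ) = (z.re : ℂ) := by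
    rw [← Complex.ofReal_sub, max_zero_sub_max_neg_zero_eq_self]
  have him : ((max z.im 0 : ℝ) : ℂ) - ((max (-z.im) 0 : ℝ) : ℂ) = (z.im : ℂ) := by
    rw [← Complex.ofReal_sub, max_zero_sub_max_neg_zero_eq_self]
  rw [hre, him]
  exact (Complex.re_add_im z).symm

/-- The Kloosterman-fraction phase has modulus `1`. [cite: Zhang2022LandauSiegel, §14 (14.8)] -/
private theorem norm_phase (q l v : ℕ) :
    ‖Complex.exp (-(2 * Real.pi * Complex.I * l * (v : ℂ) / q))‖ = 1 := by
  have : -(2 * Real.pi * Complex.I * l * (v : ℂ) / q) = ((-(2 * Real.pi * l * v / q) : ℝ) : ℂ) * I := by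
    push_cast; ring
  rw [this, Complex.norm_exp_ofReal_mul_I]

/-- **P2 PROVED from K1:** the transfer identity for nonnegative bounded weights gives the Kloosterman-fraction
transfer with constant `4B` (apply K1 to the four sign parts of `Re/Im (β(m)·e(−l m̄/q))`, each in `[0, B]`).
[cite: Zhang2022LandauSiegel, §14 (14.8); TaoTeravainen2021, §5] -/
theorem siegelFractionTransfer_of_moduliTransfer {c : ℝ} (h : SiegelModuliTransfer c) : SiegelFractionTransfer c := by
  intro ψc hψ
  refine (h ψc hψ).mono fun D _ χ _ _ hK hA β B hβ q l _ => ?_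
  have hK := hK hA
  -- the common bound of K1
  set E : ℝ := B * (bigP D * (ell D ^ 68)⁻¹) * (ell D ^ c)⁻¹ with hE
  -- the complex test function and its four parts
  set Hf : ℕ → ℂ := fun m => β m * Complex.exp (-(2 * Real.pi * Complex.I * l * (((m : ZMod q)⁻¹).val : ℂ) / q))
    with hHf
  have hHn : ∀ m, ‖Hf m‖ ≤ B := fun m => by
    simp only [hHf, norm_mul, norm_phase, mul_one]; exact hβ m
  have hB0 : 0 ≤ B := (norm_nonneg _).trans (hβ 0)
  set G₁ : ℕ → ℝ := fun m => max (Hf m).re 0 with hG₁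
  set G₂ : ℕ → ℝ := fun m => max (-(Hf m).re) 0 with hG₂
  set G₃ : ℕ → ℝ := fun m => max (Hf m).im 0 with hG₃
  set G₄ : ℕ → ℝ := fun m => max (-(Hf m).im) 0 with hG₄
  have hre : ∀ m, |(Hf m).re| ≤ B := fun m => (Complex.abs_re_le_norm _).trans (hHn m)
  have him : ∀ m, |(Hf m).im| ≤ B := fun m => (Complex.abs_im_le_norm _).trans (hHn m)
  have b₁ : ∀ m, 0 ≤ G₁ m ∧ G₁ m ≤ B := fun m =>
    ⟨le_max_right _ _, max_le ((le_abs_self _).trans (hre m)) hB0⟩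
  have b₂ : ∀ m, 0 ≤ G₂ m ∧ G₂ m ≤ B := fun m =>
    ⟨le_max_right _ _, max_le ((neg_le_abs _).trans (hre m)) hB0⟩
  have b₃ : ∀ m, 0 ≤ G₃ m ∧ G₃ m ≤ B := fun m =>
    ⟨le_max_right _ _, max_le ((le_abs_self _).trans (him m)) hB0⟩
  have b₄ : ∀ m, 0 ≤ G₄ m ∧ G₄ m ≤ B := fun m =>
    ⟨le_max_right _ _, max_le ((neg_le_abs _).trans (him m)) hB0⟩
  -- K1 on each part
  have k₁ := hK G₁ B (fun m => (b₁ m).1) (fun m => (b₁ m).2)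
  have k₂ := hK G₂ B (fun m => (b₂ m).1) (fun m => (b₂ m).2)
  have k₃ := hK G₃ B (fun m => (b₃ m).1) (fun m => (b₃ m).2)
  have k₄ := hK G₄ B (fun m => (b₄ m).1) (fun m => (b₄ m).2)
  -- the difference is the defect of `Hf`, which splits into the four real defects
  have hdiff : primeKloostermanFraction D β q l - siegelKloostermanFraction χ ψc β q l = transferDefect χ ψc Hf := by
    simp only [primeKloostermanFraction, siegelKloostermanFraction, transferDefect, hHf, mul_assoc]
  have hsplit : transferDefect χ ψc Hf
      = (transferDefect χ ψc (fun m => (G₁ m : ℂ)) - transferDefect χ ψc (fun m => (G₂ m : ℂ)))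
        + (transferDefect χ ψc (fun m => (G₃ m : ℂ)) - transferDefect χ ψc (fun m => (G₄ m : ℂ))) * I := by
    have hH : Hf = fun m => ((fun m => (G₁ m : ℂ) + (-1) * (G₂ m : ℂ)) m
        + I * ((fun m => (G₃ m : ℂ) + (-1) * (G₄ m : ℂ)) m)) := by
      funext m
      have := decomp_four (Hf m)
      simp only [hG₁, hG₂, hG₃, hG₄]
      linear_combination this
    rw [hH, transferDefect_add, transferDefect_smul, transferDefect_add, transferDefect_add,
      transferDefect_smul, transferDefect_smul]
    ring
  rw [hdiff, hsplit, transferDefect_ofReal, transferDefect_ofReal, transferDefect_ofReal, transferDefect_ofReal]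
  -- norms
  have hI : ‖(I : ℂ)‖ = 1 := Complex.norm_I
  calc _ ≤ ‖((∑ p ∈ primeWindow D, Real.log p * G₁ p - ∑ m ∈ moduliWindow D, siegelModulusWeight χ ψc m * G₁ m : ℝ) : ℂ)
            - ((∑ p ∈ primeWindow D, Real.log p * G₂ p - ∑ m ∈ moduliWindow D, siegelModulusWeight χ ψc m * G₂ m : ℝ) : ℂ)‖
          + ‖(((∑ p ∈ primeWindow D, Real.log p * G₃ p - ∑ m ∈ moduliWindow D, siegelModulusWeight χ ψc m * G₃ m : ℝ) : ℂ)
            - ((∑ p ∈ primeWindow D, Real.log p * G₄ p - ∑ m ∈ moduliWindow D, siegelModulusWeight χ ψc m * G₄ m : ℝ) : ℂ))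
              * I‖ := norm_add_le _ _
    _ ≤ (E + E) + (E + E) := by
        gcongr
        · refine (norm_sub_le _ _).trans (add_le_add ?_ ?_) <;>
            rw [Complex.norm_real, Real.norm_eq_abs]
          · exact k₁
          · exact k₂
        · rw [norm_mul, hI, mul_one]
          refine (norm_sub_le _ _).trans (add_le_add ?_ ?_) <;>
            rw [Complex.norm_real, Real.norm_eq_abs]
          · exact k₃
          · exact k₄
    _ = 4 * B * (bigP D * (ell D ^ 68)⁻¹) * (ell D ^ c)⁻¹ := by rw [hE]; ring

end FractionTransfer

/-! ### Part 6 — (A) gives a Siegel zero of quality `≥ 𝓛²⁰²¹/C` (appended 2026-08-26), MODULO the in-print dichotomy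
`montgomeryVaughan2007_theorem114_dichotomy` (MV Thm 11.4 at `s = 1`, p467873): bridge to `IsSiegelZero χ η` -/

section SiegelZeroBridge

open Literature.Barriers.Parity (IsSiegelZero)

/-- **(A) ⇒ an exceptional zero, eventually** (modulo MV Thm 11.4): there is `C > 0` such that for all large `D` and
every real primitive `χ (mod D)` with `L(1,χ) < 𝓛⁻²⁰²²`, `L(s,χ)` has a real zero `β < 1` with `1 − β ≤ C·𝓛⁻²⁰²²`.
[cite: MontgomeryVaughan2007, §11.1 Theorem 11.4 (11.7) (11.10); Zhang2022LandauSiegel, §2 Assumption (A)] -/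
theorem realZero_of_assumptionA (h : montgomeryVaughan2007_theorem114_dichotomy) :
    ∃ C : ℝ, 0 < C ∧ ForAllLarge fun D _ χ => AssumptionA D χ →
      ∃ β : ℝ, β < 1 ∧ 1 - β ≤ C * (1 / Real.log D ^ 2022) ∧ χ.LFunction (β : ℂ) = 0 := by
  obtain ⟨c₁, C, hc₁, hC, hmv⟩ := h
  refine ⟨C, hC, ForAllLarge.of_le (⌈Real.exp (max 1 (2 / c₁))⌉₊ + 4) fun D _ χ hD _ hprim hA => ?_⟩
  have hD4 : (4 : ℝ) ≤ D := by exact_mod_cast (by omega : 4 ≤ D)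
  have hDexp : Real.exp (max 1 (2 / c₁)) ≤ D :=
    (Nat.le_ceil _).trans (by exact_mod_cast (by omega : ⌈Real.exp (max 1 (2 / c₁))⌉₊ ≤ D))
  have hL : max 1 (2 / c₁) ≤ Real.log D := by
    rw [← Real.log_exp (max 1 (2 / c₁))]
    exact Real.log_le_log (Real.exp_pos _) hDexp
  have hL1 : 1 ≤ Real.log D := (le_max_left _ _).trans hL
  have hL2 : 2 / c₁ ≤ Real.log D := (le_max_right _ _).trans hL
  have hL0 : 0 < Real.log D := by linarith
  -- `log(4D) ≤ 2 log D` and `1/𝓛²⁰²² ≤ c₁/(2𝓛) ≤ c₁/log(4D)`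
  have hlog4 : Real.log (4 * D) ≤ 2 * Real.log D := by
    rw [Real.log_mul (by norm_num) (by linarith), two_mul]
    linarith [Real.log_le_log (by norm_num : (0:ℝ) < 4) hD4]
  have hlog4pos : 0 < Real.log (4 * D) := Real.log_pos (by linarith)
  have hpow : Real.log D ^ 2 ≤ Real.log D ^ (2022 : ℕ) := pow_le_pow_right₀ hL1 (by norm_num)
  have h2c : 2 * Real.log D ≤ c₁ * Real.log D ^ 2 := by
    have h2 : 2 ≤ c₁ * Real.log D := by have := (div_le_iff₀ hc₁).mp hL2; linarith
    nlinarith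
  have hsmall : 1 / Real.log D ^ 2022 ≤ c₁ / Real.log (4 * D) := by
    rw [div_le_div_iff₀ (by positivity) hlog4pos, one_mul]
    nlinarith [mul_le_mul_of_nonneg_left hpow hc₁.le]
  have hne : χ ≠ 1 := SiegelZeroQuality.ne_one_of_isPrimitive hprim (by omega)
  rcases hmv D χ (by omega) hne with hbig | ⟨β, hβ1, hβ, hz⟩
  · exact absurd (lt_of_lt_of_le hA (hsmall.trans hbig)) (lt_irrefl _)
  · exact ⟨β, hβ1, hβ.trans (mul_le_mul_of_nonneg_left hA.le hC.le), hz⟩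

/-- **(A) ⇒ a Siegel zero of quality `η ≥ 𝓛²⁰²¹/C`, eventually** (modulo MV Thm 11.4): the hypothesis
`IsSiegelZero χ η` of the tree's Tao–Teräväinen facts (`SiegelZeroDichotomy*`, e.g. `TaoTeravainen2021_eq313`,
`_lemma51_pair`) holds under Zhang's (A) with `η ≥ 𝓛²⁰²¹/C` — the quality the card's K1 exponent budget uses.
[cite: MontgomeryVaughan2007, §11.1 Theorem 11.4; TaoTeravainen2021, Definition 1.4; Zhang2022LandauSiegel, §2 (A)] -/
theorem isSiegelZero_of_assumptionA (h : montgomeryVaughan2007_theorem114_dichotomy) :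
    ∃ C : ℝ, 0 < C ∧ ForAllLarge fun D _ χ => AssumptionA D χ →
      ∃ η : ℝ, Real.log D ^ 2021 / C ≤ η ∧ IsSiegelZero χ η := by
  obtain ⟨C, hC, hev⟩ := realZero_of_assumptionA h
  refine ⟨C, hC, ?_⟩
  have hbig : ForAllLarge fun D _ _ => max 1 (10 * C) ≤ Real.log D :=
    ForAllLarge.of_le (⌈Real.exp (max 1 (10 * C))⌉₊ + 1) fun D _ χ hD _ _ => by
      have hDexp : Real.exp (max 1 (10 * C)) ≤ D :=
        (Nat.le_ceil _).trans (by exact_mod_cast (by omega : ⌈Real.exp (max 1 (10 * C))⌉₊ ≤ D))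
      rw [← Real.log_exp (max 1 (10 * C))]
      exact Real.log_le_log (Real.exp_pos _) hDexp
  refine (hev.and hbig).mono fun D _ χ hq hp hh hA => ?_
  obtain ⟨h1, hL⟩ := hh
  obtain ⟨β, hβ1, hβ, hz⟩ := h1 hA
  have hL1 : 1 ≤ Real.log D := (le_max_left _ _).trans hL
  have hL10 : 10 * C ≤ Real.log D := (le_max_right _ _).trans hL
  have hL0 : 0 < Real.log D := by linarith
  have hgap : 0 < 1 - β := by linarith
  set η : ℝ := 1 / ((1 - β) * Real.log D) with hη
  have hηpos : 0 < (1 - β) * Real.log D := mul_pos hgap hL0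
  -- quality: `𝓛²⁰²¹/C ≤ η` from `(1 − β)·𝓛²⁰²² ≤ C`
  have hq' : Real.log D ^ 2021 / C ≤ η := by
    rw [hη, div_le_div_iff₀ hC hηpos, one_mul]
    have h2 : (1 - β) * Real.log D ^ 2022 ≤ C := by
      have := mul_le_mul_of_nonneg_right hβ (by positivity : (0:ℝ) ≤ Real.log D ^ 2022)
      rwa [mul_assoc, one_div, inv_mul_cancel₀ (by positivity), mul_one] at this
    calc Real.log D ^ 2021 * ((1 - β) * Real.log D) = (1 - β) * Real.log D ^ 2022 := by ring
      _ ≤ C := h2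
  refine ⟨η, hq', hp, hq, ?_, ?_⟩
  · -- `10 ≤ η` since `𝓛²⁰²¹/C ≥ 𝓛/C ≥ 10`
    have hpow : Real.log D ^ 1 ≤ Real.log D ^ (2021 : ℕ) := pow_le_pow_right₀ hL1 (by norm_num)
    have : 10 ≤ Real.log D ^ 2021 / C := by rw [le_div_iff₀ hC, pow_one] at *; linarith
    exact this.trans hq'
  · have hβeq : 1 - 1 / (η * Real.log D) = β := by rw [hη]; field_simp; ring
    rw [hβeq]; exact hz

end SiegelZeroBridge

end Literature.NumberTheory.LFunctions.Zhang2022.KnifeEdge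

end
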